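import Literature.NumberTheory.GaloisRepresentations.AbstractReciprocityLaw
import Mathlib.GroupTheory.Solvable
import HarnessLib

/-!
# Surjectivity of Neukirch's reciprocity map for solvable Galois pairs (abstract class field theory, Weil form)

Topic `NumberTheory/GaloisRepresentations` (the setting of `AbstractClassFieldTheory.lean` /
`AbstractReciprocityMap.lean` / `AbstractReciprocityLaw.lean`); namespace
`Literature.NumberTheory.GaloisRepresentations.AbstractCFT.WeilDatum`.  THEOREMS ONLY.

J. Neukirch, *Algebraic Number Theory* [NeukirchANT1999], Ch. IV §6, Thm. (6.3): for every finite
Galois `L|K` the reciprocity map `r_{L|K} : G(L|K)^{ab} → A_K/N_{L|K}A_L` is an isomorphism.  The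
tree's `AbstractReciprocityLaw.lean` proves this for ABELIAN pairs
(`IsClassFieldTheory.exists_recMap_eq`, `mem_of_recMap_eq_one`).  This file extends the
SURJECTIVITY half to Galois pairs `V ≤ U` with SOLVABLE Galois group `U/V` — the case of local
fields (`LocalGaloisSolvable.lean`: Galois groups of finite Galois extensions of non-archimedean
local fields are solvable) — by the dévissage along the commutator quotient:
`U ⊋ U₁ := [U,U]V ⊇ V`, `(U, U₁)` abelian, `(U₁, V)` Galois with smaller index, and norm
functoriality (5.8) (`recMap_eq_map_recMap`, `recMap_eq_mk_norm_recElt`):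

* `IsClassFieldTheory.exists_recMap_eq_of_isSolvable` — for `a ∈ A^U` there is `τ ∈ U` with
  `r_{L|K}(τ) = [a]`.

Used by the local transfer theorem (Neukirch IV (5.9) at the level of `θ_E : Eˣ → Γ_E^{ab}`,
sequel of `AbstractReciprocityTransfer.lean`): it lets one realise a prescribed class
`[x] ∈ A_K/N_{L|K}A_L` by a Galois element at a NON-abelian Galois level `L`.
-/

noncomputable section

open scoped Pointwise

namespace Literature.NumberTheory.GaloisRepresentations

namespace AbstractCFT

variable {W : Type*} [Group W] {A : Type*} [CommGroup A] [MulDistribMulAction W A]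

namespace WeilDatum

variable (d : WeilDatum W A)

section Solvable

variable {U V : Subgroup W}

/-- The preimage in `U` of the commutator subgroup of `U/V`, read in `W`: membership.
(Neukirch's `G(L|L^{ab})` for the maximal abelian subextension `L^{ab}|K` of `L|K`.) [folklore] -/
private theorem mem_commPreimage_iff [(V.subgroupOf U).Normal] {x : W} :
    x ∈ ((commutator (U ⧸ V.subgroupOf U)).comap (QuotientGroup.mk' (V.subgroupOf U))).map
        U.subtype ↔
      ∃ hx : x ∈ U, (QuotientGroup.mk (⟨x, hx⟩ : U) : U ⧸ V.subgroupOf U) ∈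
        commutator (U ⧸ V.subgroupOf U) := by
  constructor
  · rintro ⟨y, hy, rfl⟩
    exact ⟨y.2, by simpa using hy⟩
  · rintro ⟨hx, h⟩
    exact ⟨⟨x, hx⟩, h, rfl⟩

variable {d} in
/-- **Surjectivity of `r_{L|K}` for solvable Galois pairs** (Neukirch IV (6.3), surjectivity half,
beyond the abelian case): for a class field theory `d`, fields `V ≤ U` with `V` normal in `U` and
`U/V` solvable, every class of `A^U/N_{V|U}A^V` is an `r_{L|K}(τ)`, `τ ∈ U`.  Dévissage: with
`U₁ ⊇ V` the preimage of `[U/V, U/V]`, `(U, U₁)` is an abelian pair (abelian case) and `(U₁, V)` a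
solvable Galois pair of smaller index (induction), glued by norm functoriality (5.8).
[cite: NeukirchANT1999, Ch. IV §6, Thm. (6.3)] -/
theorem IsClassFieldTheory.exists_recMap_eq_of_isSolvable (hcf : d.IsClassFieldTheory)
    (hU : d.IsField U) (hV : d.IsField V) (hVU : V ≤ U) [hN : (V.subgroupOf U).Normal]
    (hsolv : IsSolvable (U ⧸ V.subgroupOf U)) {a : A} (ha : a ∈ fixedBy A U) :
    haveI := d.finiteIndex hV
    ∃ τ ∈ U, d.recMap U V τ = QuotientGroup.mk a := by
  -- strong induction on the index `(U : V)`
  suffices H : ∀ (n : ℕ) (U V : Subgroup W) [(V.subgroupOf U).Normal], d.IsField U → d.IsField V →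
      V ≤ U → IsSolvable (U ⧸ V.subgroupOf U) → V.relIndex U = n →
      ∀ a ∈ fixedBy A U, ∃ τ ∈ U, ∀ [V.FiniteIndex],
        (d.recMap U V τ : A ⧸ normGroup V U) = QuotientGroup.mk a by
    haveI := d.finiteIndex hV
    obtain ⟨τ, hτ, h⟩ := H _ U V hU hV hVU hsolv rfl a ha
    exact ⟨τ, hτ, h⟩
  intro n
  induction n using Nat.strong_induction_on with
  | _ n ih =>
  intro U V hN hU hV hVU hsolv hn a ha
  haveI := d.finiteIndex hV
  haveI := d.finiteIndex hU
  have hUn : U ≤ Subgroup.normalizer (V : Set W) :=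
    (Subgroup.normal_subgroupOf_iff_le_normalizer hVU).mp hN
  by_cases hab : ∀ x ∈ U, ∀ y ∈ U, x * y * x⁻¹ * y⁻¹ ∈ V
  · -- abelian pair: the tree's reciprocity law
    obtain ⟨τ, hτ, h⟩ := hcf.exists_recMap_eq ⟨hU, hV, hVU, hab⟩ ha
    exact ⟨τ, hτ, h⟩
  · -- the commutator step `U ⊋ U₁ ⊇ V`
    let U₁ : Subgroup W :=
      ((commutator (U ⧸ V.subgroupOf U)).comap (QuotientGroup.mk' (V.subgroupOf U))).map U.subtype
    have hU₁U : U₁ ≤ U := by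
      rintro x hx
      obtain ⟨hxU, -⟩ := mem_commPreimage_iff.mp hx
      exact hxU
    have hVU₁ : V ≤ U₁ := by
      intro v hv
      refine mem_commPreimage_iff.mpr ⟨hVU hv, ?_⟩
      have : (QuotientGroup.mk (⟨v, hVU hv⟩ : U) : U ⧸ V.subgroupOf U) = 1 := by
        rw [QuotientGroup.eq_one_iff, Subgroup.mem_subgroupOf]; exact hv
      rw [this]; exact (commutator _).one_mem
    have hU₁ : d.IsField U₁ := d.isField_of_le hV hVU₁
    haveI := d.finiteIndex hU₁
    -- commutators of `U` lie in `U₁`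
    have hcommU₁ : ∀ x ∈ U, ∀ y ∈ U, x * y * x⁻¹ * y⁻¹ ∈ U₁ := by
      intro x hx y hy
      refine mem_commPreimage_iff.mpr ⟨U.mul_mem (U.mul_mem (U.mul_mem hx hy) (U.inv_mem hx))
        (U.inv_mem hy), ?_⟩
      have key := Subgroup.commutator_mem_commutator
        (Subgroup.mem_top (QuotientGroup.mk (⟨x, hx⟩ : U) : U ⧸ V.subgroupOf U))
        (Subgroup.mem_top (QuotientGroup.mk (⟨y, hy⟩ : U) : U ⧸ V.subgroupOf U))
      rw [commutatorElement_def, ← commutator_def] at key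
      have hel : (⟨x * y * x⁻¹ * y⁻¹, U.mul_mem (U.mul_mem (U.mul_mem hx hy) (U.inv_mem hx))
          (U.inv_mem hy)⟩ : U) = ⟨x, hx⟩ * ⟨y, hy⟩ * ⟨x, hx⟩⁻¹ * ⟨y, hy⟩⁻¹ := rfl
      rw [hel, QuotientGroup.mk_mul, QuotientGroup.mk_mul, QuotientGroup.mk_mul, QuotientGroup.mk_inv,
        QuotientGroup.mk_inv]
      exact key
    have hUn₁ : U ≤ Subgroup.normalizer (U₁ : Set W) := by
      intro u hu
      rw [Subgroup.mem_normalizer_iff]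
      intro x
      constructor
      · intro hx
        have hxU := hU₁U hx
        have : u * x * u⁻¹ = (u * x * u⁻¹ * x⁻¹) * x := by group
        rw [this]
        exact U₁.mul_mem (hcommU₁ u hu x hxU) hx
      · intro hx
        have hxU : x ∈ U := by
          have := U.mul_mem (U.mul_mem (U.inv_mem hu) (hU₁U hx)) hu
          simpa [mul_assoc] using this
        have : x = (u⁻¹ * (u * x * u⁻¹) * u⁻¹⁻¹ * (u * x * u⁻¹)⁻¹) * (u * x * u⁻¹) := by group
        rw [this]
        exact U₁.mul_mem (hcommU₁ u⁻¹ (U.inv_mem hu) _ (hU₁U hx)) hx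
    have habU₁ : d.IsAbelianPair U U₁ := ⟨hU, hU₁, hU₁U, hcommU₁⟩
    have hU₁n : U₁ ≤ Subgroup.normalizer (V : Set W) := hU₁U.trans hUn
    haveI hN₁ : (V.subgroupOf U₁).Normal := (Subgroup.normal_subgroupOf_iff_le_normalizer hVU₁).mpr hU₁n
    -- `U₁ ≠ U`: `U/V` is solvable and not abelian, hence not perfect
    have hne : U₁ ≠ U := by
      intro hEq
      apply hab
      intro x hx y hy
      have htop : commutator (U ⧸ V.subgroupOf U) = ⊤ := by
        rw [eq_top_iff]
        intro q _
        obtain ⟨u, rfl⟩ := QuotientGroup.mk_surjective q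
        have hu : (u : W) ∈ U₁ := by rw [hEq]; exact u.2
        rcases mem_commPreimage_iff.mp hu with ⟨hu', hmem⟩
        simpa using hmem
      have hsub : Subsingleton (U ⧸ V.subgroupOf U) := by
        by_contra hns
        rw [not_subsingleton_iff_nontrivial] at hns
        exact ne_of_lt (IsSolvable.commutator_lt_top_of_nontrivial (G := U ⧸ V.subgroupOf U)) htop
      have h1 : (QuotientGroup.mk (⟨x * y * x⁻¹ * y⁻¹,
          U.mul_mem (U.mul_mem (U.mul_mem hx hy) (U.inv_mem hx)) (U.inv_mem hy)⟩ : U) :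
          U ⧸ V.subgroupOf U) = 1 :=
        Subsingleton.elim _ _
      rw [QuotientGroup.eq_one_iff, Subgroup.mem_subgroupOf] at h1
      exact h1
    -- the index drops: `(U : V) = (U₁ : V)(U : U₁)` with `(U : U₁) ≥ 2`
    have hlt : V.relIndex U₁ < n := by
      have hmul := Subgroup.relIndex_mul_relIndex V U₁ U hVU₁ hU₁U
      have h1 : U₁.relIndex U ≠ 1 := by
        rw [Ne, Subgroup.relIndex_eq_one]; exact fun h => hne (le_antisymm hU₁U h)
      have h0 : U₁.relIndex U ≠ 0 := by
        haveI : (U₁.subgroupOf U).FiniteIndex := Subgroup.finiteIndex_of_finite_quotient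
        exact Subgroup.FiniteIndex.index_ne_zero
      have h0' : V.relIndex U₁ ≠ 0 := by
        haveI : (V.subgroupOf U₁).FiniteIndex := Subgroup.finiteIndex_of_finite_quotient
        exact Subgroup.FiniteIndex.index_ne_zero
      have h2 : 2 ≤ U₁.relIndex U := by omega
      have hpos : 0 < V.relIndex U₁ := Nat.pos_of_ne_zero h0'
      rw [← hn, ← hmul]
      nlinarith
    -- solvability of `U₁/V`: it embeds in the solvable `U/V`
    have hsolv₁ : IsSolvable (U₁ ⧸ V.subgroupOf U₁) := by
      haveI := hsolv
      let f : U₁ ⧸ V.subgroupOf U₁ →* U ⧸ V.subgroupOf U :=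
        QuotientGroup.map _ _ (Subgroup.inclusion hU₁U) (fun x hx => by
          rw [Subgroup.mem_subgroupOf] at hx
          show ((Subgroup.inclusion hU₁U x : U) : W) ∈ V
          exact hx)
      refine solvable_of_solvable_injective (f := f) ?_
      rw [injective_iff_map_eq_one]
      intro x hx
      induction x using QuotientGroup.induction_on with
      | H y =>
        rw [QuotientGroup.map_mk, QuotientGroup.eq_one_iff, Subgroup.mem_subgroupOf] at hx
        rw [QuotientGroup.eq_one_iff, Subgroup.mem_subgroupOf]
        exact hx
    -- Step 1: abelian surjectivity for `(U, U₁)`: `r_{U₁|U}(τ) = [a]`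
    obtain ⟨τ, hτU, hτ⟩ := hcf.exists_recMap_eq habU₁ ha
    -- `r_{U₁|U}(τ) = [r_{V|U}(τ)] = [c]`, so `a⁻¹ c = N_{U₁|U}(b)` with `b ∈ A^{U₁}`
    obtain ⟨c, hcU, hc⟩ := d.recMap_mem_range hU hV hUn hτU
    have hmap := hcf.recMap_eq_map_recMap hU hU₁ hU₁U hUn₁ hV hVU hUn hVU₁ hτU
    rw [hτ, hc, QuotientGroup.map_mk, MonoidHom.id_apply, QuotientGroup.eq] at hmap
    obtain ⟨b, hb, hbn⟩ := mem_normGroup_iff.mp hmap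
    -- Step 2: induction for `(U₁, V)` and `b⁻¹ ∈ A^{U₁}`
    obtain ⟨ρ, hρU₁, hρ⟩ := ih _ hlt U₁ V hU₁ hV hVU₁ hsolv₁ rfl b⁻¹ ((fixedBy A U₁).inv_mem hb)
    have hρ' : (d.recMap U₁ V ρ : A ⧸ normGroup V U₁) = QuotientGroup.mk b⁻¹ := hρ
    -- `r_{V|U}(ρ) = [N_{U₁|U}(r̃_{V|U₁}(ρ))] = [N_{U₁|U}(b⁻¹)]` modulo `N_{V|U}`
    have hρU : ρ ∈ U := hU₁U hρU₁
    have hrecρ : d.recMap U V ρ = QuotientGroup.mk (norm U₁ U b⁻¹) := by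
      rw [hcf.recMap_eq_mk_norm_recElt hU hV hVU hUn hU₁ hV hVU₁ hU₁n hU₁U le_rfl hρU₁
        (d.frobLift_mem hU₁ hρU₁) (d.degZ_frobLift_pos hU₁ hV ρ)
        (d.inv_mul_frobLift_mem hU₁ hV hVU₁ hU₁n ρ)]
      -- `recElt U₁ V (frobLift) ≡ b⁻¹` modulo `N_{V|U₁} A^V`
      have hρ'' : (QuotientGroup.mk (d.recElt U₁ V (d.frobLift U₁ V ρ)) : A ⧸ normGroup V U₁) =
          QuotientGroup.mk b⁻¹ := hρ'
      rw [QuotientGroup.eq] at hρ''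
      obtain ⟨e, he, hem⟩ := mem_normGroup_iff.mp hρ''
      rw [QuotientGroup.eq, ← norm_inv, ← norm_mul, ← hem, norm_norm hVU₁ hU₁U he]
      exact norm_mem_normGroup he
    refine ⟨τ * ρ, U.mul_mem hτU hρU, ?_⟩
    intro _
    rw [hcf.recMap_mul hU hV hVU hUn hτU hρU, hc, hrecρ, ← QuotientGroup.mk_mul, norm_inv, hbn]
    congr 1
    group

end Solvable


end WeilDatum

end AbstractCFT

end Literature.NumberTheory.GaloisRepresentations
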